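import Mathlib
import HarnessLib
import HarnessLib.Audit
import Summits.ResolutionOfSingularities.Statement
import Summits.ResolutionOfSingularities.ResolutionOfSingularities.Theses.MaxContactCut
import Literature.AlgebraicGeometry.Resolution.Blowups
import Literature.AlgebraicGeometry.Resolution.MarkedIdeals
import Literature.AlgebraicGeometry.Resolution.DiffIdealSheaf
import Literature.AlgebraicGeometry.Resolution.BlowupSequences
import Literature.AlgebraicGeometry.Resolution.EmbeddedResolutionExcellentSurfacesSequence

/-!
# MaxContactCut · Exhaustion kernels (decomp-res cell, lens-5 gen 5; filed by the route-writer decomp-res-writer-1 g3)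

ATTACK NODE on the two banked dim-4 rungs of route MaxContactCut — `LocalOrderOneResolveDimFour`
(stmt-28008, PR¹₄) and `StepContactDimFour` (stmt-28009, the generic order-reduction step in dim 4).
CRITIC row 34 (2026-08-30T05:29:28Z): «CLEARED AS ATTACK NODE on 28009 ∧ 28008 carrying a NEW LEMMA;
bridge proof re-derived and CORRECT».  Thesis of the node: THE GLOBALISATION SEAM IS EMPTY IN DIMENSION
FOUR — ordered chart exhaustion globalises every Zariski-local order-reduction engine whose centres lie in
the top locus, because (M1) weakly permissible blow-ups never raise orders and move the top locus inside its
preimage, (M2) maximal contact persists on every chart (Giraud; tree `MaximalContactPersistence`), and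
(M3) a chart centre closed in the chart but not in `Y` is replaced by its CJS-REGULARISED CLOSURE (dim ≤ 2
inside a regular excellent fourfold: tree fact `CossartJannsenSaito2020EmbeddedSequenceB`), which stays in
the top locus by semicontinuity.  Complete paper proof: HOME/decomp-res-lens-5/g5/NODE.md §2–§4
(sha256 b8a90ebb…); source draft Exhaustion.lean (sha256 8094bac2…).

Contents (0 sorry; axioms ⊆ {propext, Classical.choice, Quot.sound}):
* support DEFINITIONS `WeakAdmissible`, `WeakResolution` (BGMW Def. 3.1.3 minus the snc clause) with the
  kernels `weakAdmissible_of_admissible`, `weakResolution_of_resolution`;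
* the sliced port `MarkedThreefoldResolutionAt c` (MIR₃^(∅)(κ) at marking `c`; the all-`c` port is the route
  ASIDE `MaxContactCut.MarkedThreefoldResolution`, stmt-28616, inlined verbatim) and `MarkedFourfoldResolution`
  (lattice placement only);
* the bridge's output `ContactOrderSequenceDimFourAt n` / `ContactOrderSequenceDimFour`, THE BRIDGE
  `ExhaustionBridge` (NEW LEMMA, paper-proved; PROVER TARGET #2 of the cell: `theorem … : ExhaustionBridge`),
  and the costume glue `SequenceToStep`, `SequenceToBase` — open pieces, tagged `@[conjecture]`;
* kernels: `stepContactDimFour_of`, `localOrderOneResolveDimFour_of`, `closes` (28008 ∧ 28009 from the one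
  port + CJS + bridge + glue), the links to the route asides `exhaustionStep_of` (⟹ stmt-28617),
  `exhaustionBase_of` (⟹ stmt-28618), `pocket_of_items`, and `closes_root` through `MaxContactCut.closes`.
Print status of the port BY SLICE (critic row 34): `c = 1` any field (CossartPiltant2019 Prop. 4.4/4.3 +
CJS), `c` = max-ord over k̄ (Cutkosky2009 Thm 5.1), general `c` UNDECIDED-in-print (desk test T-X1-scope).
[Kollar2007 Thm 3.105, BierstoneGrigorievMilmanWlodarczyk2011 Thm 8.0.5, CossartJannsenSaito2020 Thm 1.4/6.9,
Cutkosky2009, CossartPiltant2019, Giraud1975]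
-/

open CategoryTheory AlgebraicGeometry
open Literature.AlgebraicGeometry.Resolution
open Summit.ResolutionOfSingularities.ResolutionOfSingularities.Theses

namespace Summit.ResolutionOfSingularities.ResolutionOfSingularities.Theorems.MaxContactCutExhaustion

/-! ## Weakly permissible sequences (the tree's BGMW notions minus the snc clause) -/

/-- `s` is WEAKLY ADMISSIBLE for the marked ideal `M = (X, 𝓘, E, μ)`: every centre is a regular scheme and
lies in the support `supp(𝓘_i, μ)` of the current controlled transform (BGMW Def. 3.1.3 (1) without (2):
no normal-crossings condition with the boundary).  Enough for ORDER REDUCTION (orders never increase, the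
ambient stays regular); the tree's `CentreSeq.IsAdmissibleFor` adds snc.  DEFINITION (support). -/
def WeakAdmissible : {X : Scheme.{0}} → CentreSeq X → MarkedIdeal X → Prop
  | _, .nil _, _ => True
  | _, .cons C rest, M => (C.support : Set _) ⊆ M.support ∧ Scheme.IsRegular C.subscheme ∧
      WeakAdmissible rest (M.transform (blowup.π C) C)

/-- `s` is a WEAK RESOLUTION of `M`: weakly admissible with empty final support `supp(𝓘_r, μ) = ∅`
(i.e. max-ord of the last controlled transform `< μ`).  DEFINITION (support). -/
def WeakResolution {X : Scheme.{0}} (s : CentreSeq X) (M : MarkedIdeal X) : Prop :=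
  WeakAdmissible s M ∧ (s.transformMarked M).support = ∅

/-- Kernel: the tree's admissible sequences are weakly admissible. -/
theorem weakAdmissible_of_admissible : ∀ {X : Scheme.{0}} (s : CentreSeq X) (M : MarkedIdeal X),
    s.IsAdmissibleFor M → WeakAdmissible s M
  | _, .nil _, _, _ => trivial
  | _, .cons C rest, M, h => by
      obtain ⟨h1, -, h3, h4⟩ := (CentreSeq.isAdmissibleFor_cons C rest M).mp h
      exact ⟨h1, h3, weakAdmissible_of_admissible rest _ h4⟩

/-- Kernel: the tree's resolutions (`CentreSeq.IsResolutionOf`, BGMW Def. 3.1.3) are weak resolutions. -/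
theorem weakResolution_of_resolution {X : Scheme.{0}} (s : CentreSeq X) (M : MarkedIdeal X)
    (h : s.IsResolutionOf M) : WeakResolution s M :=
  ⟨weakAdmissible_of_admissible s M h.1, h.2⟩

/-! ## The pieces -/

/-- **MIR₃^(∅)(κ) at marking `c` — resolution of marked ideals `(S, J, ∅, c)` on regular threefolds in
characteristic p (THE PORT, sliced by the marking).**  PORT · UNDECIDED-in-print AS TYPED (all fields k, all
markings c; snc with the own exceptional boundary as in BGMW Def. 3.1.3) · KNOWN over k̄ at c = max-ord
(Cutkosky2009 Thm 5.1) and at c = 1 over ANY field (principalization on excellent regular threefolds,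
CossartPiltant2019 Prop. 4.4/4.3, + CJS for the divisorial part) · the cell's standing port (critic rows 37 (iii),
45 (iii); census T-tame-lit rev 2, T-marked-3-lit) · not summit-implied (attack piece, declared) · ATTACKABLE
(port L).  The chart engine of round β at order `n` consumes the slice `c = n!` (marking of the coefficient
ideal, tree `MarkedIdeal.coeff`, `MarkedIdeal.factorial_le_idealOrder_coeff_comap`).
[Cutkosky2009, CossartPiltant2019, CossartJannsenSaito2020, BierstoneGrigorievMilmanWlodarczyk2011] -/
def MarkedThreefoldResolutionAt (c : ℕ) : Prop :=
  ∀ p : ℕ, p.Prime → ∀ (k : Type) [Field k] [CharP k p] (S : Scheme.{0}) (g : S ⟶ Spec (.of k)),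
    IsSeparated g → LocallyOfFiniteType g → QuasiCompact g → Scheme.IsRegular S →
    topologicalKrullDim S ≤ 3 →
    ∀ J : S.IdealSheafData, (∀ y : S, idealOrder J y ≠ ⊤) →
      ∃ t : CentreSeq S, t.IsResolutionOf (⟨J, [], c⟩ : MarkedIdeal S)

/-- MIR₃^(∅)(κ), all markings `c ≥ 1` — THE PORT is the route ASIDE `MaxContactCut.MarkedThreefoldResolution`
(stmt-28616, the sliced statement inlined verbatim); this kernel unfolds it to the sliced form. -/
theorem markedThreefoldResolutionAt_of_item (h : MaxContactCut.MarkedThreefoldResolution) :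
    ∀ c : ℕ, 1 ≤ c → MarkedThreefoldResolutionAt c :=
  fun c hc => h c hc

/-- converse repackaging: the sliced form at all `c ≥ 1` is the route aside. -/
theorem item_of_markedThreefoldResolutionAt (h : ∀ c : ℕ, 1 ≤ c → MarkedThreefoldResolutionAt c) :
    MaxContactCut.MarkedThreefoldResolution :=
  fun c hc => h c hc

/-- The same port one dimension up, for LATTICE PLACEMENT only (MIR₄^(∅) ⊇ Wild₄ in substance; never a target
of this node). UNDECIDED (≥ the located dim-4 core). [Kollar2007, Hironaka1964] -/
@[conjecture]
def MarkedFourfoldResolution : Prop :=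
  ∀ c : ℕ, 1 ≤ c → ∀ p : ℕ, p.Prime → ∀ (k : Type) [Field k] [CharP k p] (S : Scheme.{0})
    (g : S ⟶ Spec (.of k)), IsSeparated g → LocallyOfFiniteType g → QuasiCompact g → Scheme.IsRegular S →
    topologicalKrullDim S ≤ 4 →
    ∀ J : S.IdealSheafData, (∀ y : S, idealOrder J y ≠ ⊤) →
      ∃ t : CentreSeq S, t.IsResolutionOf (⟨J, [], c⟩ : MarkedIdeal S)

/-- **Glob-free global order reduction in dimension four at order `n` (THE BRIDGE'S OUTPUT, sliced).**  For
`Y/k` regular separated finite-type of dimension ≤ 4, an ideal sheaf `I` with `ord_y I ≤ n` everywhere and a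
hypersurface of maximal contact at EVERY point of order `n` (some `u ∈ Diff^{≤n−1}_{Y/k}(I)(U)` with germ in
`𝔪_y ∖ 𝔪_y²`; MaxContactCut's predicate over tree `diffIdealSheaf`, verbatim) there is a GLOBAL weakly
permissible resolution sequence of the marked ideal `(I, ∅, n)`: finitely many blow-ups of `Y` in regular
centres lying in the successive top loci, after which the controlled transform has order `< n` everywhere.
Not summit-implied (sequence form, declared) · ATTACKABLE := `ExhaustionBridge` + `MarkedThreefoldResolutionAt n!`
(no idea needed) · ≤ MIR₄^(∅)∣contact (kernel `contactOrderSequenceDimFourAt_of_markedFourfold`).  Ports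
inherited from stmt-28009: perfect-k, and port HS for `n ≥ p` with contact (the tame range `n < p` uses the
tree's PROVED going-up `CentreSeq.isResolutionOf_pushforward_of_maxContact`).  At `n = 1` the contact
hypothesis is automatic (an order-1 point has an order-1 section of `Diff⁰(I) = I`).
[Kollar2007 3.84–3.85/3.105, BierstoneGrigorievMilmanWlodarczyk2011 Lemma 3.9.4, CossartJannsenSaito2020 Thm 1.4,
Cutkosky2009, Villamayor2007] -/
def ContactOrderSequenceDimFourAt (n : ℕ) : Prop :=
  ∀ p : ℕ, p.Prime → ∀ (k : Type) [Field k] [CharP k p]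
    (Y : Scheme.{0}) (g : Y ⟶ Spec (.of k)), IsSeparated g → LocallyOfFiniteType g → QuasiCompact g →
    Scheme.IsRegular Y → topologicalKrullDim Y ≤ 4 →
    ∀ I : Y.IdealSheafData, (∀ y : Y, idealOrder I y ≤ ((n : ℕ) : ℕ∞)) →
      (∀ y : Y, idealOrder I y = ((n : ℕ) : ℕ∞) → ∃ U : Y.affineOpens, ∃ hy : y ∈ (U : Y.Opens),
        ∃ u ∈ (diffIdealSheaf (g.appTop.hom.comp (Scheme.ΓSpecIso (.of k)).inv.hom) (n - 1) I).ideal U,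
          (Y.presheaf.germ U y hy).hom u ∈ IsLocalRing.maximalIdeal (Y.presheaf.stalk y) ∧
          (Y.presheaf.germ U y hy).hom u ∉ IsLocalRing.maximalIdeal (Y.presheaf.stalk y) ^ 2) →
      ∃ t : CentreSeq Y, WeakResolution t (⟨I, [], n⟩ : MarkedIdeal Y)

/-- Glob-free global order reduction in dimension four, all orders `n ≥ 1`. See `ContactOrderSequenceDimFourAt`. -/
@[conjecture]
def ContactOrderSequenceDimFour : Prop := ∀ n : ℕ, 1 ≤ n → ContactOrderSequenceDimFourAt n

/-- **THE EXHAUSTION BRIDGE (this node's new lemma), sliced by the order `n`.**  MIR₃^(∅)(κ) at marking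
`n!` and Cossart–Jannsen–Saito's embedded resolution of reduced subschemes of dimension ≤ 2 of regular
excellent schemes (tree fact `CossartJannsenSaito2020EmbeddedSequenceB`: centres inside the strict transforms,
isomorphism over the regular locus) imply Glob-free global order reduction in dimension four at order `n`, by
ORDERED CHART EXHAUSTION WITH CJS-REGULARISED CLOSURES (module docstring; complete paper proof NODE.md §3;
every ingredient is a tree theorem, a tree fact or the port).  BRIDGE · ATTACKABLE (Lean port L; perfect-k and
HS ports inherited from stmt-28009) · NOT an idea.  [Kollar2007 Thm 3.105 (proof), BierstoneGrigorievMilman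
Wlodarczyk2011 Thm 8.0.5 (2), CossartJannsenSaito2020 Thm 1.4 / 6.9, Giraud1975, Cutkosky2009] -/
@[conjecture]
def ExhaustionBridge : Prop :=
  ∀ n : ℕ, 1 ≤ n → MarkedThreefoldResolutionAt (Nat.factorial n) →
    CossartJannsenSaito2020EmbeddedSequenceB.{0} → ContactOrderSequenceDimFourAt n

/-- **Sequence ⇒ generic step** (COSTUME(cite), port M): a global weak resolution sequence of `(I, ∅, n)`
yields `π : Y_r → Y` proper birational with `Y_r` regular (blow-ups of regular schemes in regular centres)
and a PENCIL controlled transform `I_r` (`(g, h) ↦ (g/eⁿ, h/eⁿ)` along a centre in the order-≥n locus) of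
order ≤ n − 1 everywhere with `I·𝒪_{Y_r} = 𝓜·I_r`, `𝓜` invertible, so `Bl_{I_r} Y_r ≅ Bl_{I𝒪} Y_r → Bl_I Y = Γ`
is proper birational (universal property of blowing up); the internal inductive hypothesis PR^{≤n−1}₄ of
`StepContactDimFour` resolves `Bl_{I_r} Y_r` (dim `Y_r` ≤ 4) and `Scheme.HasResolution.of_isBirational`
transports.  [Hartshorne1977 II.7.14–7.16, Kollar2007 3.30, BierstoneGrigorievMilmanWlodarczyk2011 Def 3.1.3] -/
@[conjecture]
def SequenceToStep : Prop :=
  (∀ n : ℕ, 2 ≤ n → ContactOrderSequenceDimFourAt n) → MaxContactCut.StepContactDimFour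

/-- **Sequence ⇒ base PR¹₄** (COSTUME(cite), port M): at `n = 1` contact is automatic for an order-≤1 pencil
at its support points, and an empty final support of `(I, 1)` makes `I·𝒪_{Y_r}` invertible, so the regular `Y_r`
dominates `Bl_I Y = Γ` properly birationally: `HasResolution Γ` outright (no inductive hypothesis).  With the
`n = 1` chart engine IN PRINT over any field (`MarkedThreefoldResolutionAt 1`: CossartPiltant2019 Prop. 4.4/4.3
+ CJS), PR¹₄ is CLOSED-MOD-LIBRARY + bridge port, NODE.md §2.  [CossartPiltant2019, CossartJannsenSaito2020,
Hartshorne1977 II.7] -/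
@[conjecture]
def SequenceToBase : Prop :=
  ContactOrderSequenceDimFourAt 1 → MaxContactCut.LocalOrderOneResolveDimFour

/-! ## Kernels -/

/-- The port is monotone in the dimension bound (sanity: MIR₄^(∅) ⟹ MIR₃^(∅)). -/
theorem markedThreefoldResolution_of_markedFourfold (h : MarkedFourfoldResolution) :
    MaxContactCut.MarkedThreefoldResolution := by
  intro c hc p hp k _ _ S g hg1 hg2 hg3 hS hdim J hJ
  exact h c hc p hp k S g hg1 hg2 hg3 hS (hdim.trans (by norm_num)) J hJ

/-- Lattice placement: the bridge's output at order `n ≥ 1` is implied by (is the contact slice of) MIR₄^(∅). -/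
theorem contactOrderSequenceDimFourAt_of_markedFourfold (h : MarkedFourfoldResolution) {n : ℕ}
    (hn : 1 ≤ n) : ContactOrderSequenceDimFourAt n := by
  intro p hp k _ _ Y g hg1 hg2 hg3 hY hdim I hord _hcontact
  have hfin : ∀ y : Y, idealOrder I y ≠ ⊤ := fun y =>
    ne_top_of_le_ne_top (ENat.coe_ne_top n) (hord y)
  obtain ⟨t, ht⟩ := h n hn p hp k Y g hg1 hg2 hg3 hY hdim I hfin
  exact ⟨t, weakResolution_of_resolution t _ ht⟩

/-- The bridge applied at order `n`: MIR₃^(∅)(κ) at marking `n!` + CJS ⟹ Glob-free global order reduction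
in dimension four at order `n`. -/
theorem contactOrderSequenceDimFourAt_of {n : ℕ} (hn : 1 ≤ n)
    (hM : MarkedThreefoldResolutionAt (Nat.factorial n))
    (hC : CossartJannsenSaito2020EmbeddedSequenceB.{0}) (hB : ExhaustionBridge) :
    ContactOrderSequenceDimFourAt n :=
  hB n hn hM hC

/-- The bridge applied at all orders. -/
theorem contactOrderSequenceDimFour_of (hM : MaxContactCut.MarkedThreefoldResolution)
    (hC : CossartJannsenSaito2020EmbeddedSequenceB.{0}) (hB : ExhaustionBridge) :
    ContactOrderSequenceDimFour :=
  fun n hn => hB n hn (hM _ (Nat.succ_le_of_lt (Nat.factorial_pos n))) hC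

/-- **StepContact₄ (stmt-28009) from ONE port** (MIR₃^(∅)(κ)), CJS, the bridge and costume glue —
Globalisation₄ is not among the hypotheses. -/
theorem stepContactDimFour_of (hM : MaxContactCut.MarkedThreefoldResolution)
    (hC : CossartJannsenSaito2020EmbeddedSequenceB.{0}) (hB : ExhaustionBridge) (hS : SequenceToStep) :
    MaxContactCut.StepContactDimFour :=
  hS fun n hn => contactOrderSequenceDimFour_of hM hC hB n (le_trans (by norm_num) hn)

/-- **PR¹₄ (stmt-28008 = OrderCut 27132|₄) without Globalisation₄**, from the `c = 1` slice of the port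
(IN PRINT over any field), CJS, the bridge and costume glue. -/
theorem localOrderOneResolveDimFour_of (h1 : MarkedThreefoldResolutionAt 1)
    (hC : CossartJannsenSaito2020EmbeddedSequenceB.{0}) (hB : ExhaustionBridge) (hS₁ : SequenceToBase) :
    MaxContactCut.LocalOrderOneResolveDimFour :=
  hS₁ (hB 1 le_rfl (by rw [Nat.factorial_one]; exact h1) hC)

/-- **The attack node's deciding implication**: the pieces give BOTH banked rungs that carried the
«globalisation seam» — the dim-4 pocket of the order/contact axis is closed modulo the single port
(route aside 28616) plus the printed CJS fact, the bridge and costume glue. -/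
theorem closes (hM : MaxContactCut.MarkedThreefoldResolution) (hC : CossartJannsenSaito2020EmbeddedSequenceB.{0})
    (hB : ExhaustionBridge) (hS : SequenceToStep) (hS₁ : SequenceToBase) :
    MaxContactCut.LocalOrderOneResolveDimFour ∧ MaxContactCut.StepContactDimFour :=
  ⟨localOrderOneResolveDimFour_of (hM 1 le_rfl) hC hB hS₁, stepContactDimFour_of hM hC hB hS⟩

/-! ## Links to the route asides ExhaustionStep (stmt-28617) and ExhaustionBase (stmt-28618) -/

/-- the bridge and the step glue give the route aside `MaxContactCut.ExhaustionStep` (X1 inlined → CJS → 28009). -/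
theorem exhaustionStep_of (hB : ExhaustionBridge) (hS : SequenceToStep) : MaxContactCut.ExhaustionStep :=
  fun hM hC => stepContactDimFour_of hM hC hB hS

/-- the bridge at `n = 1` and the base glue give the route aside `MaxContactCut.ExhaustionBase` (X1(1) → CJS → 28008). -/
theorem exhaustionBase_of (hB : ExhaustionBridge) (hS₁ : SequenceToBase) : MaxContactCut.ExhaustionBase :=
  fun h1 hC => localOrderOneResolveDimFour_of h1 hC hB hS₁

/-- modus ponens over the three route asides: X1, X2, X3 and the CJS fact give 28008 ∧ 28009. -/
theorem pocket_of_items (h1 : MaxContactCut.MarkedThreefoldResolution) (h2 : MaxContactCut.ExhaustionStep)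
    (h3 : MaxContactCut.ExhaustionBase) (hC : CossartJannsenSaito2020EmbeddedSequenceB.{0}) :
    MaxContactCut.LocalOrderOneResolveDimFour ∧ MaxContactCut.StepContactDimFour :=
  ⟨h3 (h1 1 le_rfl) hC, h2 h1 hC⟩

/-- ROOT by name: the node sits under route MaxContactCut's cone and changes none of its binders (the
located dim-4 core StepContactFree₄ = StepCFHigher₄ ∪ StepPICore₄ is untouched — residual axis score 0, declared). -/
theorem closes_root (hR : MaxContactCut.RegularRoofs) (hP : MaxContactCut.PencilReduction)
    (hB : MaxContactCut.OrderBound) (h1 : MaxContactCut.LocalOrderOneResolve)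
    (hC : MaxContactCut.StepContact) (hF : MaxContactCut.StepContactFree) :
    _root_.ResolutionOfSingularities :=
  MaxContactCut.closes hR hP hB h1 hC hF

end Summit.ResolutionOfSingularities.ResolutionOfSingularities.Theorems.MaxContactCutExhaustion
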